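import Mathlib.Tactic.Linarith
import Summits.CriticalPhenomena.PercolationContinuityZ3.Theorems.PercNearOneGluingNoHeavyLowerTailSahiCTCPara2Moves
import Summits.CriticalPhenomena.PercolationContinuityZ3.Theorems.PercNearOneGluingNoHeavyLowerTailSahiCTCDownLYM
import HarnessLib

/-!
# `NoHeavyLowerTail` (crux stmt-CriticalPhenomena-4575), P3 lane: THE REDUCTION THEOREM FOR `PARA₂` with X-DEAD POINTS (memo g17 §1.4 + §10) —
# every pair (P arbitrary down-set, Q spanning) dominates coefficientwise a flag pair on the live set with no common non-edge

Support file (seat `prim-l12-p3`, gen 18; `--supports stmt-CriticalPhenomena-4575`).  Companions `…SahiCTCPara2Moves` (the moves), `…SahiCTCDownLYM`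
(the general Z-face bracket), `…SahiCTCReduction` (the G-forms).  The open case of `PARA₂` in the c = 2 induction is 'Q = K_Z spanning (all sets of size
≤ 1 are faces), P = K_X an arbitrary complex' (g9 table: PARA2 ml-N₁ and ll).  Points `d` with `{d} ∉ K_X` are X-DEAD; `L` = the live points.
* `cliqueCxOn L E` : the flag complex of the 2-sets `E` restricted to subsets of `L` (a down-set; its 2-sets are the 2-sets of `E` inside `L`; it contains
  `∅` and the singletons of `L`);
* `coeff_para2_antitone_X` / `coeff_para2_antitone_Z` : iterating the moves — enlarging `K_X` by ≥3-sets and 2-sets absent from `K_Z` lowers `PARA₂`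
  (needs `K_Z` spanning); enlarging `K_Z` by ≥3-sets and 2-sets absent from `K_X` lowers `PARA₂` (needs `K_X` a down-set: general Z-face bracket);
* **`coeff_para2_reduction`** : for a down-set `K_X ∋ ∅` with live set `L`, a spanning down-set `K_Z`, and `A ⊆ ω` consisting of pairs inside `L`:
  `PARA₂(cliqueCxOn L (E_X ∪ A), cliqueCx (E_Z ∪ (ω ∖ A))) ≤ PARA₂(K_X, K_Z)` coefficientwise, and the reduced pair has no common non-edge
  (`omega_para2_reduction_eq_empty`) — every pair touching a dead point is a Z-edge there, as in the dead-point model of memo g17 §10.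
Nothing is asserted about the crux; no positivity of `PARA₂` is claimed.
-/

namespace Summit.CriticalPhenomena.PercolationContinuityZ3.Theorems.SahiCTCForms

open Finset MvPolynomial SahiCTCGenFun

variable {α : Type*} [DecidableEq α] [Fintype α]

/-! ### Iterating the moves -/

/-- Enlarging `K_X` by sets of size `≥ 3` and 2-sets not in `K_Z` lowers `PARA₂` coefficientwise, when `K_Z` contains all sets of size ≤ 1. [this work] -/
theorem coeff_para2_antitone_X {KZ : Finset (Finset α)} (hZ1 : ∀ S : Finset α, #S ≤ 1 → S ∈ KZ) :
    ∀ (k : ℕ) (KX₀ KX : Finset (Finset α)), #(KX \ KX₀) = k → KX₀ ⊆ KX → (∀ S ∈ KX, S ∉ KX₀ → 3 ≤ #S ∨ (#S = 2 ∧ S ∉ KZ)) →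
      ∀ n : α →₀ ℕ, (PARA2 KX KZ).coeff n ≤ (PARA2 KX₀ KZ).coeff n := by
  intro k
  induction k with
  | zero =>
    intro KX₀ KX hk hsub _ n
    have : KX = KX₀ := Subset.antisymm (Finset.sdiff_eq_empty_iff_subset.1 (card_eq_zero.1 hk)) hsub
    rw [this]
  | succ k ih =>
    intro KX₀ KX hk hsub hdiff n
    obtain ⟨S, hS⟩ : (KX \ KX₀).Nonempty := card_pos.1 (by omega)
    obtain ⟨hSK, hS0⟩ := mem_sdiff.1 hS
    have hstep : (PARA2 KX KZ).coeff n ≤ (PARA2 (KX.erase S) KZ).coeff n := coeff_para2_le_erase_X hZ1 hSK (hdiff S hSK hS0) n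
    have hk' : #(KX.erase S \ KX₀) = k := by
      have : KX.erase S \ KX₀ = (KX \ KX₀).erase S := by ext T; simp only [mem_sdiff, mem_erase]; tauto
      rw [this, card_erase_of_mem hS, hk]; rfl
    have hsub' : KX₀ ⊆ KX.erase S := fun T hT => mem_erase.2 ⟨fun h => hS0 (h ▸ hT), hsub hT⟩
    exact hstep.trans (ih KX₀ (KX.erase S) hk' hsub' (fun T hT hT0 => hdiff T (mem_of_mem_erase hT) hT0) n)

/-- Z-face move monotonicity for an ARBITRARY down-set `K_X` (general bracket, `…SahiCTCDownLYM`). [this work] -/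
theorem coeff_para2_le_erase_Zface' {KX KZ : Finset (Finset α)} (hKX : IsLowerSet (KX : Set (Finset α))) {F : Finset α} (hF : F ∈ KZ)
    (hF3 : 3 ≤ #F) (n : α →₀ ℕ) : (PARA2 KX KZ).coeff n ≤ (PARA2 KX (KZ.erase F)).coeff n := by
  rw [para2_erase_Zface hF hF3, coeff_add, mul_assoc]
  have hM := coeff_monomial_mul_nonneg F (coeff_Zface_bracket_nonneg_of_isLowerSet hKX)
  have := coeff_mul_nonneg (P := ee 2) (fun m => by unfold ee; exact coeff_gf_nonneg _ m) hM n
  linarith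

/-- Enlarging `K_Z` by sets of size `≥ 3` and 2-sets not in `K_X` lowers `PARA₂` coefficientwise, when `K_X` is a down-set. [this work] -/
theorem coeff_para2_antitone_Z {KX : Finset (Finset α)} (hKX : IsLowerSet (KX : Set (Finset α))) :
    ∀ (k : ℕ) (KZ₀ KZ : Finset (Finset α)), #(KZ \ KZ₀) = k → KZ₀ ⊆ KZ → (∀ S ∈ KZ, S ∉ KZ₀ → 3 ≤ #S ∨ (#S = 2 ∧ S ∉ KX)) →
      ∀ n : α →₀ ℕ, (PARA2 KX KZ).coeff n ≤ (PARA2 KX KZ₀).coeff n := by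
  intro k
  induction k with
  | zero =>
    intro KZ₀ KZ hk hsub _ n
    have : KZ = KZ₀ := Subset.antisymm (Finset.sdiff_eq_empty_iff_subset.1 (card_eq_zero.1 hk)) hsub
    rw [this]
  | succ k ih =>
    intro KZ₀ KZ hk hsub hdiff n
    obtain ⟨S, hS⟩ : (KZ \ KZ₀).Nonempty := card_pos.1 (by omega)
    obtain ⟨hSK, hS0⟩ := mem_sdiff.1 hS
    have hstep : (PARA2 KX KZ).coeff n ≤ (PARA2 KX (KZ.erase S)).coeff n := by
      rcases hdiff S hSK hS0 with h3 | ⟨h2, hX⟩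
      · exact coeff_para2_le_erase_Zface' hKX hSK h3 n
      · exact coeff_para2_le_erase_Zedge hSK hX h2 n
    have hk' : #(KZ.erase S \ KZ₀) = k := by
      have : KZ.erase S \ KZ₀ = (KZ \ KZ₀).erase S := by ext T; simp only [mem_sdiff, mem_erase]; tauto
      rw [this, card_erase_of_mem hS, hk]; rfl
    have hsub' : KZ₀ ⊆ KZ.erase S := fun T hT => mem_erase.2 ⟨fun h => hS0 (h ▸ hT), hsub hT⟩
    exact hstep.trans (ih KZ₀ (KZ.erase S) hk' hsub' (fun T hT hT0 => hdiff T (mem_of_mem_erase hT) hT0) n)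

/-! ### Flag complexes on a live set -/

/-- The clique complex of `E` restricted to subsets of `L`. [this work] -/
def cliqueCxOn (L : Finset α) (E : Finset (Finset α)) : Finset (Finset α) := (cliqueCx E).filter fun S => S ⊆ L

omit [DecidableEq α] in
/-- Membership. [this work] -/
theorem mem_cliqueCxOn [DecidableEq α] {L : Finset α} {E : Finset (Finset α)} {S : Finset α} :
    S ∈ cliqueCxOn L E ↔ S ⊆ L ∧ ∀ e, e ⊆ S → #e = 2 → e ∈ E := by
  rw [cliqueCxOn, mem_filter, mem_cliqueCx]; tauto

/-- `cliqueCxOn` is a down-set. [this work] -/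
theorem isLowerSet_cliqueCxOn (L : Finset α) (E : Finset (Finset α)) : IsLowerSet ((cliqueCxOn L E : Finset (Finset α)) : Set (Finset α)) := by
  intro S T hTS hS
  rw [Finset.mem_coe, mem_cliqueCxOn] at hS ⊢
  exact ⟨hTS.trans hS.1, fun e he h2 => hS.2 e (he.trans hTS) h2⟩

/-- The live set of a complex: points whose singleton is a face. [this work] -/
def liveSet (KX : Finset (Finset α)) : Finset α := univ.filter fun v => ({v} : Finset α) ∈ KX

/-- Faces of a down-set lie inside its live set. [this work] -/
theorem subset_liveSet_of_mem {KX : Finset (Finset α)} (hKX : IsLowerSet (KX : Set (Finset α))) {S : Finset α} (hS : S ∈ KX) : S ⊆ liveSet KX := by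
  intro v hv
  rw [liveSet, mem_filter]
  exact ⟨mem_univ _, hKX (show ({v} : Finset α) ⊆ S from singleton_subset_iff.2 hv) hS⟩

/-- The reduced X-complex (dead-point model): flag complex of `E_X ∪ A` on the live set. [this work] -/
def redXd (KX A : Finset (Finset α)) : Finset (Finset α) := cliqueCxOn (liveSet KX) (edgesOf KX ∪ A)

/-- **THE REDUCTION THEOREM FOR `PARA₂`** (P arbitrary, Q spanning; memo g17 §1.4 + the dead-point model of §10).  Let `K_X ∋ ∅` be a down-set with live set `L`,
`K_Z` a down-set containing every set of size ≤ 1, and `A ⊆ ω` a set of common non-edges handed to `X` (all other common non-edges — in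
particular every pair at a dead point — go to `Z`; for `ω = ∅` afterwards take `A` inside `L`, `omega_para2_reduction_eq_empty`).  Then
`PARA₂(cliqueCxOn L (E_X ∪ A), cliqueCx (E_Z ∪ (ω ∖ A))) ≤ PARA₂(K_X, K_Z)` coefficientwise. [this work] -/
theorem coeff_para2_reduction {KX KZ A : Finset (Finset α)} (hKX : IsLowerSet (KX : Set (Finset α))) (h0 : (∅ : Finset α) ∈ KX)
    (hKZ : IsLowerSet (KZ : Set (Finset α))) (hZ1 : ∀ S : Finset α, #S ≤ 1 → S ∈ KZ) (hA : A ⊆ omega KX KZ) (n : α →₀ ℕ) :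
    (PARA2 (redXd KX A) (redZ KX KZ A)).coeff n ≤ (PARA2 KX KZ).coeff n := by
  -- step 1: enlarge K_X to the flag complex on the live set
  have hsubX : KX ⊆ redXd KX A := by
    intro S hS
    rw [redXd, mem_cliqueCxOn]
    exact ⟨subset_liveSet_of_mem hKX hS, fun e he h2 => mem_union_left _ (mem_filter.2 ⟨mem_powerset.2 (subset_univ _), h2, hKX he hS⟩)⟩
  have hdiffX : ∀ S ∈ redXd KX A, S ∉ KX → 3 ≤ #S ∨ (#S = 2 ∧ S ∉ KZ) := by
    intro S hS hSX
    rw [redXd, mem_cliqueCxOn] at hS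
    by_cases h0' : #S = 0
    · exact absurd (card_eq_zero.1 h0' ▸ h0) hSX
    by_cases h1 : #S = 1
    · obtain ⟨v, rfl⟩ := card_eq_one.1 h1
      have hv : v ∈ liveSet KX := hS.1 (mem_singleton_self v)
      exact absurd (mem_filter.1 hv).2 hSX
    by_cases h2 : #S = 2
    · right; refine ⟨h2, ?_⟩
      rcases mem_union.1 (hS.2 S Subset.rfl h2) with h | h
      · exact absurd (mem_filter.1 h).2.2 hSX
      · exact (mem_filter.1 (hA h)).2.2.2
    · left; omega
  have step1 := coeff_para2_antitone_X hZ1 _ KX (redXd KX A) rfl hsubX hdiffX n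
  -- step 2: enlarge K_Z, against the down-set redXd
  have hsubZ : KZ ⊆ redZ KX KZ A := subset_cliqueCx_of_isLowerSet hKZ subset_union_left
  have hdiffZ : ∀ S ∈ redZ KX KZ A, S ∉ KZ → 3 ≤ #S ∨ (#S = 2 ∧ S ∉ redXd KX A) := by
    intro S hS hSZ
    by_cases h1 : #S ≤ 1
    · exact absurd (hZ1 S h1) hSZ
    by_cases h2 : #S = 2
    · right; refine ⟨h2, ?_⟩
      have hmem := (two_mem_cliqueCx_iff _ h2).1 hS
      rcases mem_union.1 hmem with h | h
      · exact absurd (mem_filter.1 h).2.2 hSZ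
      · obtain ⟨hω, hnA⟩ := mem_sdiff.1 h
        intro hSX'
        rw [redXd, mem_cliqueCxOn] at hSX'
        rcases mem_union.1 (hSX'.2 S Subset.rfl h2) with h' | h'
        · exact (mem_filter.1 hω).2.2.1 (mem_filter.1 h').2.2
        · exact hnA h'
    · left; omega
  have step2 := coeff_para2_antitone_Z (isLowerSet_cliqueCxOn _ _) _ KZ (redZ KX KZ A) rfl hsubZ hdiffZ n
  exact step2.trans step1

/-- The reduced `PARA₂` pair has no common non-edge (every pair at a dead point became a Z-edge). [this work] -/
theorem omega_para2_reduction_eq_empty {KX KZ A : Finset (Finset α)} (hKX : IsLowerSet (KX : Set (Finset α)))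
    (hAL : ∀ e ∈ A, e ⊆ liveSet KX) : omega (redXd KX A) (redZ KX KZ A) = ∅ := by
  refine filter_eq_empty_iff.2 fun S _ h => ?_
  obtain ⟨h2, hX, hZ⟩ := h
  rw [redZ, two_mem_cliqueCx_iff _ h2] at hZ
  have hX' : ¬ (S ⊆ liveSet KX ∧ S ∈ edgesOf KX ∪ A) := by
    intro ⟨hL, hE⟩
    apply hX
    rw [redXd, mem_cliqueCxOn]
    refine ⟨hL, fun e he he2 => ?_⟩
    have : e = S := eq_of_subset_of_card_le he (by rw [h2, he2])
    rw [this]; exact hE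
  by_cases hSX : S ∈ KX
  · exact hX' ⟨subset_liveSet_of_mem hKX hSX, mem_union_left _ (mem_filter.2 ⟨mem_powerset.2 (subset_univ _), h2, hSX⟩)⟩
  by_cases hSZ : S ∈ KZ
  · exact hZ (mem_union_left _ (mem_filter.2 ⟨mem_powerset.2 (subset_univ _), h2, hSZ⟩))
  have hω : S ∈ omega KX KZ := mem_filter.2 ⟨mem_powerset.2 (subset_univ _), h2, hSX, hSZ⟩
  by_cases hSA : S ∈ A
  · exact hX' ⟨hAL S hSA, mem_union_right _ hSA⟩
  · exact hZ (mem_union_right _ (mem_sdiff.2 ⟨hω, hSA⟩))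

end Summit.CriticalPhenomena.PercolationContinuityZ3.Theorems.SahiCTCForms
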